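import Summits.QuantumAdvantage.QuantumAdvantage.Theorems.CharDialTokenDialG
import Summits.QuantumAdvantage.QuantumAdvantage.Theorems.CharDialTokenDialE
import HarnessLib

/-!
# CharDial tower — the TOKEN DIAL, part H: the SEMANTIC TOKEN DIAL (eighth dial; presentation-free) and the eight-dial pieces

Cell `decomp-qadv`, lens 6 («barrier-complement carving»), generation 19 (REV2); supports the LOW child `JLinLowResidual5`
(stmt-QuantumAdvantage-27206) and the HIGH child `JLinResidualHigh5` (27207) of `WalkHardFJLinOdd` (32604).  Theses-free.

* `TowerDefs.TokenHypSem p K y` — the SEMANTIC TOKEN hypothesis, a property of the STRATEGY `y` alone: some adjacent pair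
  `(s, t = s+1)` has at most `K` SEMANTIC READERS (cuts whose answer moves under the transposition of `s, t` on some input with
  `u_s ≠ u_t`; every other cut is swap-stable there) and its rich set (inputs with `u_s ≠ u_t`, every cut other than cut `t` inert,
  cut `t` accepting before or after) has size `≥ 2ⁿ/(4p)`.  `TokenHypLoc K D → TokenHypSem p K D.strat` (`tokenHypSem_of_tokenHypLoc`:
  a dead cut is swap-stable), so class⁸ ⊆ class⁷ ⊆ class⁶.
* ★ `tokenSem_hard K` — THE EIGHTH DECIDED DIAL: for every prime `p ≠ 3` and every `K`, eventually in `n`, a `log₂ n`-junta ⊕ form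
  presentation whose strategy meets `TokenHypSem p K` wins on `≤ (1 − 1/(24p))·2ⁿ` inputs for every residue `c` (part G's `engineSem`
  + part E's `eventually_smallK`).
* the eight-dial residual pieces `TowerDefs.LowResidual8Side B K`, `ResidualHigh8Side B K`, `Residual8Side K`: the five decided
  presentation-level escape clauses, and the presentation-FREE clause `¬ TokenHypSem p K y` on the strategy; for EVERY `K` the
  equivalences `lowResidual5_iff_lowResidual8`, `residualHigh5_iff_residualHigh8`, `residual5_iff_residual8` (`absorb_tokenSem`, which
  presents `y` from `JLinHyp` by choice), and `7 ⟺ 8`, `6 ⟺ 8` through them.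
0 sorry.  Part I states the junction with the filed items by name and certifies the HIGH⁸ class inhabited.
-/

set_option autoImplicit false

open Finset

namespace Summit.QuantumAdvantage.AdviceFreeQNC0.JLinPeel

namespace TowerDefs

variable {n : ℕ}

/-- **the SEMANTIC TOKEN DIAL hypothesis with `K` readers** on a STRATEGY: some adjacent pair `(s, t = s+1)` and a set `G` of at most
`K` cuts such that every cut outside `G` is swap-stable (`y g u^{(st)} = y g u` whenever `u_s ≠ u_t`), and at least `2ⁿ/(4p)` inputs
`u` have `u_s ≠ u_t`, every cut other than the cut numbered `t` inert at `u`, and the cut numbered `t` accepting `u` or its transpose. -/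
def TokenHypSem (p K : ℕ) (y : Fin (n + 1) → (Fin n → Bool) → Bool) : Prop :=
  ∃ s t : Fin n, t.val = s.val + 1 ∧ ∃ G : Finset (Fin (n + 1)), G.card ≤ K ∧
    (∀ g, g ∉ G → ∀ u : Fin n → Bool, u s ≠ u t → y g (SegMove.segCompl u s.val (s.val + 2)) = y g u) ∧
    2 ^ n ≤ 4 * p * (Finset.univ.filter fun u : Fin n → Bool =>
      u s ≠ u t ∧ (∀ g : Fin (n + 1), g ≠ ⟨t.val, Nat.lt_succ_of_lt t.isLt⟩ →
          y g (SegMove.segCompl u s.val (s.val + 2)) = y g u) ∧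
        (y ⟨t.val, Nat.lt_succ_of_lt t.isLt⟩ u = true ∨
          y ⟨t.val, Nat.lt_succ_of_lt t.isLt⟩ (SegMove.segCompl u s.val (s.val + 2)) = true)).card

/-- **piece RESIDUAL-HIGH⁸ (`K` semantic readers).** `ResidualHigh5Side` with the presentation-free eighth escape clause
`¬ TokenHypSem p K y`. -/
def ResidualHigh8Side (B : ℕ → ℕ) (K : ℕ) : Prop :=
  ∀ (p : ℕ) [Fact p.Prime], 5 ≤ p → ∃ θ : ℝ, θ < 1 ∧ ∃ n₀ : ℕ, ∀ n ≥ n₀, ∀ c : ℕ,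
    ∀ y : Fin (n + 1) → (Fin n → Bool) → Bool, JLinHyp p n y → ¬ LowVar B n y → ¬ TokenHypSem p K y →
      (∀ D : JLinPeel.JLinData p n, D.strat = y → (∀ g, (D.J g).card ≤ Nat.log 2 n) →
          ¬ SpanHyp D ∧ ¬ SparseHyp D ∧ ¬ BlockHyp D ∧ ¬ NullHyp D ∧ ¬ MaskHyp D) →
        ((Finset.univ.filter fun u : Fin n → Bool => ringWinU c y u = true).card : ℝ) ≤ θ * (2 : ℝ) ^ n

/-- **piece LOW-RESIDUAL⁸ (`K` semantic readers).** `LowResidual5Side` with the presentation-free eighth escape clause. -/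
def LowResidual8Side (B : ℕ → ℕ) (K : ℕ) : Prop :=
  ∀ (p : ℕ) [Fact p.Prime], 5 ≤ p → ∃ θ : ℝ, θ < 1 ∧ ∃ n₀ : ℕ, ∀ n ≥ n₀, ∀ c : ℕ,
    ∀ y : Fin (n + 1) → (Fin n → Bool) → Bool, JLinHyp p n y → LowVar B n y → ¬ TokenHypSem p K y →
      (∀ D : JLinPeel.JLinData p n, D.strat = y → (∀ g, (D.J g).card ≤ Nat.log 2 n) →
          ¬ SpanHyp D ∧ ¬ SparseHyp D ∧ ¬ BlockHyp D ∧ ¬ NullHyp D ∧ ¬ MaskHyp D) →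
        ((Finset.univ.filter fun u : Fin n → Bool => ringWinU c y u = true).card : ℝ) ≤ θ * (2 : ℝ) ^ n

/-- **the EIGHT-DIAL RESIDUAL of T (`K` semantic readers)** (no variation condition). -/
def Residual8Side (K : ℕ) : Prop :=
  ∀ (p : ℕ) [Fact p.Prime], 5 ≤ p → ∃ θ : ℝ, θ < 1 ∧ ∃ n₀ : ℕ, ∀ n ≥ n₀, ∀ c : ℕ,
    ∀ y : Fin (n + 1) → (Fin n → Bool) → Bool, JLinHyp p n y → ¬ TokenHypSem p K y →
      (∀ D : JLinPeel.JLinData p n, D.strat = y → (∀ g, (D.J g).card ≤ Nat.log 2 n) →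
          ¬ SpanHyp D ∧ ¬ SparseHyp D ∧ ¬ BlockHyp D ∧ ¬ NullHyp D ∧ ¬ MaskHyp D) →
        ((Finset.univ.filter fun u : Fin n → Bool => ringWinU c y u = true).card : ℝ) ≤ θ * (2 : ℝ) ^ n

end TowerDefs

namespace TokenDial

open SegMove

variable {n : ℕ}

/-! ### the dial theorem -/

section Dial

variable {p : ℕ} [hp : Fact p.Prime]

omit hp in
/-- the rich set of `TokenHypSem` is `richLoc` (`rfl`). -/
theorem richLoc_eq' (y : Fin (n + 1) → (Fin n → Bool) → Bool) (s t : Fin n) :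
    (univ.filter fun u : Fin n → Bool =>
      u s ≠ u t ∧ (∀ g : Fin (n + 1), g ≠ ⟨t.val, Nat.lt_succ_of_lt t.isLt⟩ →
          y g (segCompl u s.val (s.val + 2)) = y g u) ∧
        (y ⟨t.val, Nat.lt_succ_of_lt t.isLt⟩ u = true ∨
          y ⟨t.val, Nat.lt_succ_of_lt t.isLt⟩ (segCompl u s.val (s.val + 2)) = true)) = richLoc y s t := rfl

omit hp in
/-- class⁸ ⊆ class⁷: a pair dead outside `G` is swap-stable outside `G`, so `TokenHypLoc K D → TokenHypSem p K D.strat`. -/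
theorem tokenHypSem_of_tokenHypLoc (K : ℕ) (D : JLinPeel.JLinData p n) :
    TowerDefs.TokenHypLoc K D → TowerDefs.TokenHypSem p K D.strat := by
  rintro ⟨s, t, hst, G, hGK, hdead, hrich⟩
  exact ⟨s, t, hst, G, hGK, fun g hg u hne => swapStable_of_dead D s t hst g (hdead g hg) u hne, hrich⟩

omit hp in
/-- class⁸ ⊆ class⁶. -/
theorem tokenHypSem_of_tokenHyp (K : ℕ) (D : JLinPeel.JLinData p n) :
    TowerDefs.TokenHyp D → TowerDefs.TokenHypSem p K D.strat :=
  fun h => tokenHypSem_of_tokenHypLoc K D (tokenHypLoc_of_tokenHyp K D h)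

/-- ★ **THE SEMANTIC TOKEN DIAL (eighth decided dial).** for every prime `p ≠ 3` and every `K`, eventually in `n`: a `log₂ n`-junta ⊕
form presentation whose strategy meets `TokenHypSem p K` wins on at most `(1 − 1/(24p))·2ⁿ` inputs, for every residue `c`. -/
theorem tokenSem_hard (K : ℕ) (hp3 : p ≠ 3) : ∃ n₀ : ℕ, ∀ n ≥ n₀, ∀ (c : ℕ) (D : JLinPeel.JLinData p n),
    (∀ g, (D.J g).card ≤ Nat.log 2 n) → TowerDefs.TokenHypSem p K D.strat →
      ((univ.filter fun u : Fin n → Bool => ringWinU c D.strat u = true).card : ℝ)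
        ≤ (1 - 1 / (24 * p)) * (2 : ℝ) ^ n := by
  have hp1 : 1 ≤ p := hp.out.one_lt.le
  obtain ⟨n₀, hn₀⟩ := eventually_smallK p hp1 K
  refine ⟨max n₀ 1, fun n hn c D hJ hT => ?_⟩
  have hn1 : 1 ≤ n := le_trans (le_max_right _ _) hn
  obtain ⟨s, t, hst, G, hGK, hS, hrich⟩ := hT
  rw [richLoc_eq'] at hrich
  have hE := engineSem hp3 c D s t hst (insert (cut t) G) (mem_insert_self _ _) fun g hg u hne =>
    hS g (fun h => hg (mem_insert_of_mem h)) u hne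
  have hsmall := hn₀ n (le_trans (le_max_left _ _) hn)
  obtain ⟨hc0, -⟩ := cos_facts hp1
  have hpR : (1 : ℝ) ≤ p := by exact_mod_cast hp1
  -- sizes
  have hG' : (insert (cut t) G).card ≤ K + 1 := (card_insert_le _ _).trans (by omega)
  have hsumJ : ∑ g ∈ insert (cut t) G, (D.J g).card ≤ (K + 1) * Nat.log 2 n := by
    refine (sum_le_card_nsmul _ _ _ fun g _ => hJ g).trans ?_
    rw [smul_eq_mul]
    exact Nat.mul_le_mul_right _ hG'
  have h2J : (2 : ℝ) ^ (∑ g ∈ insert (cut t) G, (D.J g).card) ≤ (n : ℝ) ^ (K + 1) := by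
    have h1 : 2 ^ (∑ g ∈ insert (cut t) G, (D.J g).card) ≤ 2 ^ ((K + 1) * Nat.log 2 n) :=
      Nat.pow_le_pow_right (by norm_num) hsumJ
    have h2 : 2 ^ ((K + 1) * Nat.log 2 n) ≤ n ^ (K + 1) := by
      rw [mul_comm, pow_mul]
      exact Nat.pow_le_pow_left (Nat.pow_log_le_self 2 (by omega)) _
    exact_mod_cast h1.trans h2
  have hpG : (p : ℝ) ^ (insert (cut t) G).card ≤ (p : ℝ) ^ (K + 1) := pow_le_pow_right₀ hpR hG'
  -- the richness, in ℝ
  have hR : (2 : ℝ) ^ n ≤ 4 * p * ((richLoc D.strat s t).card : ℝ) := by exact_mod_cast hrich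
  -- the error term
  have hcn : 0 ≤ Real.cos (Real.pi / (3 * p)) ^ n := pow_nonneg hc0 n
  have herr : 8 * (p : ℝ) ^ (insert (cut t) G).card * (2 : ℝ) ^ (∑ g ∈ insert (cut t) G, (D.J g).card)
      * (2 * Real.cos (Real.pi / (3 * p))) ^ n ≤ (2 : ℝ) ^ n / (8 * p) := by
    rw [mul_pow, le_div_iff₀ (by positivity)]
    have hA : (p : ℝ) ^ (insert (cut t) G).card * (2 : ℝ) ^ (∑ g ∈ insert (cut t) G, (D.J g).card)
        ≤ (p : ℝ) ^ (K + 1) * (n : ℝ) ^ (K + 1) := mul_le_mul hpG h2J (by positivity) (by positivity)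
    have h3 : (0 : ℝ) ≤ 2 ^ n := by positivity
    calc 8 * (p : ℝ) ^ (insert (cut t) G).card * (2 : ℝ) ^ (∑ g ∈ insert (cut t) G, (D.J g).card)
          * ((2 : ℝ) ^ n * Real.cos (Real.pi / (3 * p)) ^ n) * (8 * p)
        = 64 * (p : ℝ) * ((p : ℝ) ^ (insert (cut t) G).card * (2 : ℝ) ^ (∑ g ∈ insert (cut t) G, (D.J g).card))
          * Real.cos (Real.pi / (3 * p)) ^ n * 2 ^ n := by ring
      _ ≤ 64 * (p : ℝ) * ((p : ℝ) ^ (K + 1) * (n : ℝ) ^ (K + 1)) * Real.cos (Real.pi / (3 * p)) ^ n * 2 ^ n := by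
          gcongr
      _ = (64 * (p : ℝ) ^ (K + 2) * (n : ℝ) ^ (K + 1) * Real.cos (Real.pi / (3 * p)) ^ n) * 2 ^ n := by ring
      _ ≤ 1 * 2 ^ n := mul_le_mul_of_nonneg_right hsmall h3
      _ = (2 : ℝ) ^ n := one_mul _
  have hp0 : (0 : ℝ) < p := by linarith
  have key : 3 * ((univ.filter fun u : Fin n → Bool => ringWinU c D.strat u = true).card : ℝ)
      ≤ 3 * (2 : ℝ) ^ n - (2 : ℝ) ^ n / (4 * p) + (2 : ℝ) ^ n / (8 * p) := by
    have h4 : (2 : ℝ) ^ n / (4 * p) ≤ ((richLoc D.strat s t).card : ℝ) := by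
      rw [div_le_iff₀ (by positivity)]; linarith
    linarith
  have h5 : 3 * (2 : ℝ) ^ n - (2 : ℝ) ^ n / (4 * p) + (2 : ℝ) ^ n / (8 * p) = 3 * ((1 - 1 / (24 * p)) * (2 : ℝ) ^ n) := by
    field_simp; ring
  linarith

end Dial

/-! ### the eighth escape clause: each five-dial piece is EQUIVALENT to its eight-dial residual, every `K` -/

section Junction

/-- class⁸ ⊆ class⁵: the five-dial pieces give the eight-dial pieces. -/
theorem residual8_of_residual5 (K : ℕ) : TowerDefs.Residual5Side → TowerDefs.Residual8Side K := by
  intro h p _ hp5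
  obtain ⟨θ, hθ, n₀, hn₀⟩ := h p hp5
  exact ⟨θ, hθ, n₀, fun n hn c y hy _ hesc => hn₀ n hn c y hy hesc⟩

/-- class⁸ ⊆ class⁵ on the LOW side. -/
theorem lowResidual8_of_lowResidual5 (B : ℕ → ℕ) (K : ℕ) :
    TowerDefs.LowResidual5Side B → TowerDefs.LowResidual8Side B K := by
  intro h p _ hp5
  obtain ⟨θ, hθ, n₀, hn₀⟩ := h p hp5
  exact ⟨θ, hθ, n₀, fun n hn c y hy hV _ hesc => hn₀ n hn c y hy hV hesc⟩

/-- class⁸ ⊆ class⁵ on the HIGH side. -/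
theorem residualHigh8_of_residualHigh5 (B : ℕ → ℕ) (K : ℕ) :
    TowerDefs.ResidualHigh5Side B → TowerDefs.ResidualHigh8Side B K := by
  intro h p _ hp5
  obtain ⟨θ, hθ, n₀, hn₀⟩ := h p hp5
  exact ⟨θ, hθ, n₀, fun n hn c y hy hV _ hesc => hn₀ n hn c y hy hV hesc⟩

/-- **absorbing the semantic token dial** (the common step): under a side condition `V` on the strategy, the eight-dial residual
piece gives the five-dial piece, with `θ := max θ₈ (1 − 1/(24p))`; a strategy meeting `TokenHypSem` is PRESENTED (by choice from
`JLinHyp`) and handed to `tokenSem_hard`. -/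
theorem absorb_tokenSem (V : (p n : ℕ) → (Fin (n + 1) → (Fin n → Bool) → Bool) → Prop) (K : ℕ)
    (h8 : ∀ (p : ℕ) [Fact p.Prime], 5 ≤ p → ∃ θ : ℝ, θ < 1 ∧ ∃ n₀ : ℕ, ∀ n ≥ n₀, ∀ c : ℕ,
      ∀ y : Fin (n + 1) → (Fin n → Bool) → Bool, TowerDefs.JLinHyp p n y → V p n y → ¬ TowerDefs.TokenHypSem p K y →
        (∀ D : JLinPeel.JLinData p n, D.strat = y → (∀ g, (D.J g).card ≤ Nat.log 2 n) →
            ¬ TowerDefs.SpanHyp D ∧ ¬ TowerDefs.SparseHyp D ∧ ¬ TowerDefs.BlockHyp D ∧ ¬ TowerDefs.NullHyp D ∧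
              ¬ TowerDefs.MaskHyp D) →
          ((Finset.univ.filter fun u : Fin n → Bool => ringWinU c y u = true).card : ℝ) ≤ θ * (2 : ℝ) ^ n) :
    ∀ (p : ℕ) [Fact p.Prime], 5 ≤ p → ∃ θ : ℝ, θ < 1 ∧ ∃ n₀ : ℕ, ∀ n ≥ n₀, ∀ c : ℕ,
      ∀ y : Fin (n + 1) → (Fin n → Bool) → Bool, TowerDefs.JLinHyp p n y → V p n y →
        (∀ D : JLinPeel.JLinData p n, D.strat = y → (∀ g, (D.J g).card ≤ Nat.log 2 n) →
            ¬ TowerDefs.SpanHyp D ∧ ¬ TowerDefs.SparseHyp D ∧ ¬ TowerDefs.BlockHyp D ∧ ¬ TowerDefs.NullHyp D ∧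
              ¬ TowerDefs.MaskHyp D) →
          ((Finset.univ.filter fun u : Fin n → Bool => ringWinU c y u = true).card : ℝ) ≤ θ * (2 : ℝ) ^ n := by
  intro p _ hp5
  have hp3 : p ≠ 3 := by omega
  obtain ⟨θ, hθ, n₈, hn₈⟩ := h8 p hp5
  obtain ⟨n₁, hn₁⟩ := tokenSem_hard (p := p) K hp3
  have hpR : (0 : ℝ) < p := by exact_mod_cast (show 0 < p by omega)
  have hθ' : (1 : ℝ) - 1 / (24 * p) < 1 := by
    have : (0 : ℝ) < 1 / (24 * p) := by positivity
    linarith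
  refine ⟨max θ (1 - 1 / (24 * p)), max_lt hθ hθ', max n₈ n₁, fun n hn c y hy hV hesc => ?_⟩
  have h2n : (0 : ℝ) ≤ (2 : ℝ) ^ n := by positivity
  by_cases hsem : TowerDefs.TokenHypSem p K y
  · have hy' := hy
    unfold TowerDefs.JLinHyp at hy'
    choose J hJ a h hdep hrep using hy'
    let D : JLinPeel.JLinData p n := ⟨J, a, h, fun g u v huv s => hdep g u v huv s⟩
    have hD : D.strat = y := by
      funext g u
      exact (hrep g u).symm
    have hsem' : TowerDefs.TokenHypSem p K D.strat := by rw [hD]; exact hsem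
    have h := hn₁ n (le_trans (le_max_right _ _) hn) c D hJ hsem'
    rw [hD] at h
    exact h.trans (mul_le_mul_of_nonneg_right (le_max_right _ _) h2n)
  · have h := hn₈ n (le_trans (le_max_left _ _) hn) c y hy hV hsem hesc
    exact h.trans (mul_le_mul_of_nonneg_right (le_max_left _ _) h2n)

/-- ★ the eight-dial residual gives the five-dial residual (semantic token dial absorbed), every `K`. -/
theorem residual5_of_residual8 (K : ℕ) : TowerDefs.Residual8Side K → TowerDefs.Residual5Side := by
  intro h8
  have h := absorb_tokenSem (fun _ _ _ => True) K (fun p _ hp5 => by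
    obtain ⟨θ, hθ, n₀, hn₀⟩ := h8 p hp5
    exact ⟨θ, hθ, n₀, fun n hn c y hy _ hS hesc => hn₀ n hn c y hy hS hesc⟩)
  intro p _ hp5
  obtain ⟨θ, hθ, n₀, hn₀⟩ := h p hp5
  exact ⟨θ, hθ, n₀, fun n hn c y hy hesc => hn₀ n hn c y hy trivial hesc⟩

/-- ★ LOW-RESIDUAL⁸ gives LOW-RESIDUAL⁵ (semantic token dial absorbed), every schedule `B`, every `K`. -/
theorem lowResidual5_of_lowResidual8 (B : ℕ → ℕ) (K : ℕ) :
    TowerDefs.LowResidual8Side B K → TowerDefs.LowResidual5Side B :=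
  fun h8 => absorb_tokenSem (fun _ n y => TowerDefs.LowVar B n y) K h8

/-- ★ RESIDUAL-HIGH⁸ gives RESIDUAL-HIGH⁵ (semantic token dial absorbed), every schedule `B`, every `K`. -/
theorem residualHigh5_of_residualHigh8 (B : ℕ → ℕ) (K : ℕ) :
    TowerDefs.ResidualHigh8Side B K → TowerDefs.ResidualHigh5Side B :=
  fun h8 => absorb_tokenSem (fun _ n y => ¬ TowerDefs.LowVar B n y) K h8

/-- ★★ RESIDUAL⁵ ⟺ RESIDUAL⁸(K), every `K`. -/
theorem residual5_iff_residual8 (K : ℕ) : TowerDefs.Residual5Side ↔ TowerDefs.Residual8Side K :=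
  ⟨residual8_of_residual5 K, residual5_of_residual8 K⟩

/-- ★★ LOW-RESIDUAL⁵ ⟺ LOW-RESIDUAL⁸(K), every schedule `B`, every `K`. -/
theorem lowResidual5_iff_lowResidual8 (B : ℕ → ℕ) (K : ℕ) :
    TowerDefs.LowResidual5Side B ↔ TowerDefs.LowResidual8Side B K :=
  ⟨lowResidual8_of_lowResidual5 B K, lowResidual5_of_lowResidual8 B K⟩

/-- ★★ RESIDUAL-HIGH⁵ ⟺ RESIDUAL-HIGH⁸(K), every schedule `B`, every `K`. -/
theorem residualHigh5_iff_residualHigh8 (B : ℕ → ℕ) (K : ℕ) :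
    TowerDefs.ResidualHigh5Side B ↔ TowerDefs.ResidualHigh8Side B K :=
  ⟨residualHigh8_of_residualHigh5 B K, residualHigh5_of_residualHigh8 B K⟩

/-- ★ LOW-RESIDUAL⁷(K) ⟺ LOW-RESIDUAL⁸(K') (through LOW-RESIDUAL⁵), every `B`, `K`, `K'`. -/
theorem lowResidual7_iff_lowResidual8 (B : ℕ → ℕ) (K K' : ℕ) :
    TowerDefs.LowResidual7Side B K ↔ TowerDefs.LowResidual8Side B K' :=
  (lowResidual5_iff_lowResidual7 B K).symm.trans (lowResidual5_iff_lowResidual8 B K')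

/-- ★ RESIDUAL-HIGH⁷(K) ⟺ RESIDUAL-HIGH⁸(K') (through RESIDUAL-HIGH⁵), every `B`, `K`, `K'`. -/
theorem residualHigh7_iff_residualHigh8 (B : ℕ → ℕ) (K K' : ℕ) :
    TowerDefs.ResidualHigh7Side B K ↔ TowerDefs.ResidualHigh8Side B K' :=
  (residualHigh5_iff_residualHigh7 B K).symm.trans (residualHigh5_iff_residualHigh8 B K')

/-- ★ LOW-RESIDUAL⁶ ⟺ LOW-RESIDUAL⁸(K), every `B`, `K`. -/
theorem lowResidual6_iff_lowResidual8 (B : ℕ → ℕ) (K : ℕ) :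
    TowerDefs.LowResidual6Side B ↔ TowerDefs.LowResidual8Side B K :=
  (lowResidual5_iff_lowResidual6 B).symm.trans (lowResidual5_iff_lowResidual8 B K)

/-- ★ RESIDUAL-HIGH⁶ ⟺ RESIDUAL-HIGH⁸(K), every `B`, `K`. -/
theorem residualHigh6_iff_residualHigh8 (B : ℕ → ℕ) (K : ℕ) :
    TowerDefs.ResidualHigh6Side B ↔ TowerDefs.ResidualHigh8Side B K :=
  (residualHigh5_iff_residualHigh6 B).symm.trans (residualHigh5_iff_residualHigh8 B K)

end Junction

end TokenDial

end Summit.QuantumAdvantage.AdviceFreeQNC0.JLinPeel
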